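import Mathlib.Topology.Irreducible
import HarnessLib

/-!
# A space covered by preirreducible open subsets which pairwise meet is preirreducible

Topic `AlgebraicGeometry/Morphisms`; namespace `Literature.AlgebraicGeometry.Morphisms`. THEOREMS ONLY, Mathlib-only imports.

[GortzWedhorn2020, Exercise 2.9]: if `X = ⋃_i U_i` with every `U_i` open and irreducible and `U_i ∩ U_j ≠ ∅` for all `i, j`, then `X`
is irreducible. (The tree has the two-set case ★ `Morphisms/GeometricallyIrreducibleOfTwoCharts.isPreirreducible_univ_of_union_of_isOpen`;
this is the family version, used for the standard chart covers of Grassmannians / projective bundles.) Proof: every non-empty open `W`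
meets some `U_i`, and `U_i ∩ W`, `U_i ∩ U_{i₀}` are non-empty opens of the preirreducible `U_i`, so `W` meets `U_{i₀}`; two non-empty
opens both meeting `U_{i₀}` in non-empty opens meet inside `U_{i₀}`.

## References
* [GortzWedhorn2020] U. Görtz, T. Wedhorn, *Algebraic Geometry I*, 2nd ed. (2020), Exercise 2.9; §(3.5).
-/

namespace Literature.AlgebraicGeometry.Morphisms

/-- **A space covered by preirreducible OPEN subsets which pairwise meet is preirreducible.** [cite: GortzWedhorn2020, Exercise 2.9] -/
theorem isPreirreducible_univ_of_iUnion_of_isOpen {X : Type*} [TopologicalSpace X] {ι : Type*} {U : ι → Set X}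
    (hO : ∀ i, IsOpen (U i)) (hcover : ⋃ i, U i = Set.univ) (hU : ∀ i, IsPreirreducible (U i))
    (hmeet : ∀ i j, (U i ∩ U j).Nonempty) : IsPreirreducible (Set.univ : Set X) := by
  -- every non-empty open `W` meets every `U i₀`
  have key : ∀ (i₀ : ι) (W : Set X), IsOpen W → W.Nonempty → (U i₀ ∩ W).Nonempty := by
    rintro i₀ W hW ⟨z, hzW⟩
    have hz : z ∈ ⋃ i, U i := by rw [hcover]; trivial
    obtain ⟨i, hzi⟩ := Set.mem_iUnion.mp hz
    obtain ⟨y, hyi, hyi₀⟩ := hmeet i i₀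
    obtain ⟨x, -, hxW, hx₀⟩ := hU i W (U i₀) hW (hO i₀) ⟨z, hzi, hzW⟩ ⟨y, hyi, hyi₀⟩
    exact ⟨x, hx₀, hxW⟩
  intro V W hV hW hZV hZW
  obtain ⟨z, -, hzV⟩ := hZV
  have hz : z ∈ ⋃ i, U i := by rw [hcover]; trivial
  obtain ⟨i₀, -⟩ := Set.mem_iUnion.mp hz
  obtain ⟨x, -, hxVW⟩ := hU i₀ V W hV hW (key i₀ V hV ⟨z, hzV⟩) (key i₀ W hW (by
    obtain ⟨w, -, hwW⟩ := hZW
    exact ⟨w, hwW⟩))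
  exact ⟨x, Set.mem_univ x, hxVW⟩

/-- **Irreducible-space form**: a non-empty space covered by preirreducible open subsets which pairwise meet is irreducible.
[cite: GortzWedhorn2020, Exercise 2.9] -/
theorem irreducibleSpace_of_iUnion_of_isOpen {X : Type*} [TopologicalSpace X] [Nonempty X] {ι : Type*} {U : ι → Set X}
    (hO : ∀ i, IsOpen (U i)) (hcover : ⋃ i, U i = Set.univ) (hU : ∀ i, IsPreirreducible (U i))
    (hmeet : ∀ i j, (U i ∩ U j).Nonempty) : IrreducibleSpace X :=
  { isPreirreducible_univ := isPreirreducible_univ_of_iUnion_of_isOpen hO hcover hU hmeet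
    toNonempty := inferInstance }

/-- **Range form** (for chart covers): a non-empty space covered by the ranges of continuous maps from irreducible spaces, the
ranges being open and pairwise meeting, is irreducible. [cite: GortzWedhorn2020, Exercise 2.9] -/
theorem irreducibleSpace_of_iUnion_range {X : Type*} [TopologicalSpace X] [Nonempty X] {ι : Type*} {Y : ι → Type*}
    [∀ i, TopologicalSpace (Y i)] [∀ i, IrreducibleSpace (Y i)] (f : ∀ i, Y i → X) (hf : ∀ i, Continuous (f i))
    (hO : ∀ i, IsOpen (Set.range (f i))) (hcover : ⋃ i, Set.range (f i) = Set.univ)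
    (hmeet : ∀ i j, (Set.range (f i) ∩ Set.range (f j)).Nonempty) : IrreducibleSpace X :=
  irreducibleSpace_of_iUnion_of_isOpen hO hcover (fun i => by
    rw [← Set.image_univ]
    exact (PreirreducibleSpace.isPreirreducible_univ (X := Y i)).image (f i) (hf i).continuousOn) hmeet

end Literature.AlgebraicGeometry.Morphisms
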